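/-
Copyright (c) 2026 the pub-hodgecm-mathlib formalisation cell (harness21).  Prover seat hodgecm-mathlib-F0P3-p03 (g15): road «S3-ram» (LEAD F0P3a-plan (g12∕g13); owner
F0P3a-p06 (g15)); junction J-PACK v2-iso (pen F0P3a-p01 (g17); S45 hand F0P3a-p02 (g17)), rows DIST ∕ ANISOTROPIC TWIN of the isoceles wave (file 2 of 2); 2026-09-02.
-/
import Literature.NumberTheory.Automorphic.UnitaryLatticeTreeIsocelesRegionCriterionRamified   -- file 1 (this seat): the region criterion; brings ★ p847610 (frames, `dist_root_eq_of_frames`), ★ p847534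
import HarnessLib

/-!
# The lattice graph of a hermitian space — THE ISOCELES REGION: DEPTH = CONTENT, THE HYPERBOLICITY CONSTRAINT, THE ANISOTROPIC TWIN, AND «DIST» (tame-ramified place)
# (Bruhat–Tits 1972 §10; Kottwitz 1986 §3; Serre, *Trees* II.1.1)

Topic `NumberTheory/Automorphic`; namespace `Literature.NumberTheory.Automorphic.UnitaryLatticeTree`.  THEOREMS ONLY (no definition, no instance, no notation, no named fact,
no `sorry`); kernel lane `--supports stmt-HodgeConjecture-24833`.  Cell `pub/hodgecm-mathlib` (D-0151), crux H413; road «S3-ram» (Literature seeding, count-neutral); junction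
(J★), ISOCELES wave (S45 sockets `row_regionCard` ∕ `row_pooledLineCounts`, hand F0P3a-p02 (g17); rows DIST ∕ anisotropic twin, bus 2026-09-02T01:51Z ∕ 01:57Z; numerics
B-p14 (g39) census 8a5ec485: per isoceles row two AXIS literals with `|R| = 1 + 2q·Σ_{i<s'} qⁱ` and two BARE-ROOT literals with `|R| = 1`).

Sequel of file 1 (`…IsocelesRegionCriterionRamified`: for self-dual `M`, `LEV[M](ϖ^{d₀}) ↔ u_{i₀} ∈ M ∧ ϖ^{s'}u_k ∈ M`).  Notation as there: eigenframe `γ = A·diag(s)·A⁻¹`,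
`u_m = A e_m`, `c(z) = A⁻¹z`, Gram `diag(d)∕(−det diag d)`, isolated index `i₀`, close pair `{j, k}` with gap EXACTLY `|ϖ|^{d₀+2s'}`.

§4 DEPTH = CONTENT.  For self-dual `M ∋ u_{i₀}`: `|c_k(z)| ≤ max(1, |c_j(z)|)` for `z ∈ M` (`⟨z,z⟩ ∈ 𝒪`, `|c_{i₀}(z)| ≤ 1`), so the `u_j`- and `u_k`-contents agree; with an
integral frame `ϖⁿ·𝒪³ ≤ M ↔ ϖⁿ·u_k ∈ M`, hence `latticeDepth M ≤ n ↔ ϖⁿu_k ∈ M` and, given the frames of the tree (★ `dist_root_eq_of_frames`), `dist(r₀, v) ≤ 2n ↔ ϖⁿu_k ∈ v`.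
§5 THE HYPERBOLICITY CONSTRAINT.  Self-dual `M ∋ u_{i₀}` with `u_k ∉ M` forces `−d_j∕d_k` to be a norm residue (`∃ t, |t| = 1, |d_j + tσ(t)d_k| < 1`): `u_k ∉ M = M♯` gives
`x ∈ M` with `|c_k(x)| > 1`, the two close coordinates have the same size and `d_jN(c_j) + d_kN(c_k)` cancels.  Hence the ANISOTROPIC TWIN: if `−d_j∕d_k` is not a norm
residue, the only self-dual lattice with `LEV(ϖ^{d₀})` is the root `𝒪³`.  §6 DIST: every self-dual vertex with `LEV(ϖ^{d₀})` is within `2s'` of the root, and no self-dual vertex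
at distance `2s' + 2` carries the token (the region's vertices at distance `2s'` are END vertices) — frames form and tame-ramified form.

* §4 `v_coord_le_max_one_v_coord`, `pow_smul_coe_mulVec_single_mem_iff_forall_v_le`, `pow_smul_coe_mulVec_single_mem_of_ne`, **`scaleLattice_pow_stdLattice_le_iff_pow_smul_mem`**,
  **`latticeDepth_le_iff_pow_smul_mem`**, **`dist_root_le_iff_pow_smul_mem_of_frames`**.
* §5 **`exists_v_add_mul_norm_lt_one_of_not_mem`** (hyperbolicity), **`eq_stdLattice_of_lev_of_anisotropic`** (the anisotropic twin: `R = {r₀}`).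
* §6 **`dist_root_le_of_lev_of_frames`** ∕ **`dist_root_le_of_lev_of_neg`**, **`not_lev_of_dist_root_eq_of_frames`** ∕ **`not_lev_of_dist_root_eq_of_neg`** (DIST).

HONEST LABEL: HC_CM is proved only modulo the 2 remaining named inputs (hLiu418 24832, h413 24833) until rung 0 closes; nothing printed is asserted here (module algebra over a
valuation ring and the rooted-tree dictionary); «S3-ram» has no books consequence.

## References
* [BruhatTits1972] F. Bruhat, J. Tits, *Groupes réductifs sur un corps local I*, Publ. Math. IHÉS 41 (1972), §10 (lattice models of the rank-one building; fixed points of tori).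
* [Kottwitz1986] R. E. Kottwitz, *Base change for unit elements of Hecke algebras*, Compositio Math. 60 (1986), §3 (fixed lattices of a torus element: split lattices of bounded content).
* [Serre1980Trees] J.-P. Serre, *Trees* (1980), Ch. II §1.1 (lattices, distance from a base lattice).
* [Tits1979] J. Tits, *Reductive groups over local fields*, PSPM 33.1 (1979), §3.5.
-/

set_option autoImplicit false

noncomputable section

open scoped Valued WithZero Matrix MatrixGroups

namespace Literature.NumberTheory.Automorphic.UnitaryLatticeTree

open Literature.NumberTheory.Automorphic Literature.NumberTheory.Automorphic.HermitianLattice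

variable {K : Type*} [Field K] [Valued K ℤᵐ⁰] {σ : K →+* K} {ϖ : K}

/-! ## §4 Depth and distance: a split self-dual lattice has depth `n` iff its `u_k`-content is `n` -/

omit [Valued K ℤᵐ⁰] in
/-- A sum over `Fin 3` along three distinct indices. [cite: Serre1980Trees, II.1.1] -/
theorem sum_eq_add_add_of_ne {β : Type*} [AddCommMonoid β] (f : Fin 3 → β) {i₀ j k : Fin 3} (hj : j ≠ i₀) (hk : k ≠ i₀) (hjk : j ≠ k) :
    ∑ i, f i = f i₀ + f j + f k := by
  fin_cases i₀ <;> fin_cases j <;> fin_cases k <;> simp (config := { decide := true }) at hj hk hjk ⊢ <;>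
    simp only [Fin.sum_univ_three] <;> abel

omit [Valued K ℤᵐ⁰] in
/-- `A·c = Σ_m c_m·(A e_m)`. [cite: Kottwitz1986, §3] -/
theorem mulVec_eq_sum_smul_mulVec_single (A : Matrix (Fin 3) (Fin 3) K) (c : Fin 3 → K) : A *ᵥ c = ∑ m, c m • (A *ᵥ Pi.single m 1) := by
  ext i
  simp only [Finset.sum_apply, Pi.smul_apply, Matrix.mulVec_single_one, Matrix.col_apply, smul_eq_mul, Matrix.mulVec, dotProduct]
  exact Finset.sum_congr rfl fun m _ => mul_comm _ _

/-- **THE TWO CLOSE COORDINATES HAVE THE SAME SIZE BEYOND `𝒪`**: for self-dual `M ∋ u_{i₀}` and `z ∈ M`, `|c_k(z)| ≤ max(1, |c_j(z)|)` (`⟨z,z⟩ ∈ 𝒪` with `|c_{i₀}(z)| ≤ 1`).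
[cite: Kottwitz1986, §3] [cite: BruhatTits1972, §10] -/
theorem v_coord_le_max_one_v_coord (hσ : ∀ x, σ (σ x) = x) (hvσ : ∀ a, Valued.v (σ a) = Valued.v a)
    (A : GL (Fin 3) K) {d : Fin 3 → K} (hd : ∀ i, Valued.v (d i) = 1)
    (hdA : Matrix.diagonal d = (-(Matrix.diagonal d).det) • formCongr σ A ((StdForm.antidiagonal 3).over K))
    {M : Submodule 𝒪[K] (Fin 3 → K)} (hM : IsSelfDualLattice σ ϖ ((StdForm.antidiagonal 3).over K) M) {i₀ j k : Fin 3} (hj : j ≠ i₀) (hk : k ≠ i₀) (hjk : j ≠ k)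
    (hu : (A : Matrix (Fin 3) (Fin 3) K) *ᵥ Pi.single i₀ 1 ∈ M) {z : Fin 3 → K} (hz : z ∈ M) :
    Valued.v ((((A⁻¹ : GL (Fin 3) K) : Matrix (Fin 3) (Fin 3) K) *ᵥ z) k) ≤ max 1 (Valued.v ((((A⁻¹ : GL (Fin 3) K) : Matrix (Fin 3) (Fin 3) K) *ᵥ z) j)) := by
  have hd0 : ∀ i, d i ≠ 0 := fun i h0 => by have h := hd i; rw [h0, map_zero] at h; exact zero_ne_one h
  have hκ := v_inv_neg_det_diagonal_eq_one hd
  have hint : ∀ {x w : Fin 3 → K}, x ∈ M → w ∈ M → Valued.v (pairing σ ((StdForm.antidiagonal 3).over K) x w) ≤ 1 := fun hx hw => by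
    rw [pairing_antidiagonal]; exact v_B₀_le_one_of_isSelfDualLattice hσ hvσ hM hx hw
  set c : Fin 3 → K := (((A⁻¹ : GL (Fin 3) K) : Matrix (Fin 3) (Fin 3) K)) *ᵥ z with hc
  -- `|c_{i₀}| ≤ 1`
  have h0 : Valued.v (c i₀) ≤ 1 := by
    have h := hint hu hz
    rwa [pairing_single_coe_mulVec_eq A hd0 hdA, map_mul, map_mul, hκ, hd i₀, one_mul, one_mul] at h
  -- `⟨z,z⟩ = κ₀ Σ σ(c_i) d_i c_i`
  have hzz := hint hz hz
  conv at hzz => rw [← coe_mulVec_inv_mulVec A z, ← hc, pairing_coe_mulVec_coe_mulVec_eq_sum A hd0 hdA, map_mul, hκ, one_mul,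
    sum_eq_add_add_of_ne (fun i => σ (c i) * d i * c i) hj hk hjk]
  have hvf : ∀ i, Valued.v (σ (c i) * d i * c i) = Valued.v (c i) * Valued.v (c i) := fun i => by rw [map_mul, map_mul, hvσ, hd i, mul_one]
  by_contra hlt
  rw [not_le, max_lt_iff] at hlt
  obtain ⟨h1k, hjk'⟩ := hlt
  have hkk : Valued.v (c k) < Valued.v (c k) * Valued.v (c k) := by
    calc Valued.v (c k) = Valued.v (c k) * 1 := (mul_one _).symm
      _ < Valued.v (c k) * Valued.v (c k) := mul_lt_mul_of_pos_left h1k (zero_lt_one.trans h1k)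
  have hi₀lt : Valued.v (σ (c i₀) * d i₀ * c i₀) < Valued.v (σ (c k) * d k * c k) := by
    rw [hvf, hvf]
    calc Valued.v (c i₀) * Valued.v (c i₀) ≤ 1 * 1 := mul_le_mul' h0 h0
      _ = 1 := one_mul _
      _ < Valued.v (c k) := h1k
      _ < Valued.v (c k) * Valued.v (c k) := hkk
  have hjlt : Valued.v (σ (c j) * d j * c j) < Valued.v (σ (c k) * d k * c k) := by
    rw [hvf, hvf]; exact mul_lt_mul'' hjk' hjk' zero_le zero_le
  have hsum : Valued.v (σ (c i₀) * d i₀ * c i₀ + σ (c j) * d j * c j + σ (c k) * d k * c k) = Valued.v (c k) * Valued.v (c k) := by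
    rw [Valuation.map_add_eq_of_lt_right _ (lt_of_le_of_lt (Valuation.map_add _ _ _) (max_lt hi₀lt hjlt)), hvf]
  rw [hsum] at hzz
  exact absurd (lt_of_lt_of_le (lt_trans h1k hkk) hzz) (lt_irrefl 1)

/-- **`ϖⁿ·u_m ∈ M` iff `|ϖ|ⁿ·|c_m(z)| ≤ 1` for all `z ∈ M`** (self-dual `M`: integrality one way, `M = M♯` the other). [cite: Kottwitz1986, §3] -/
theorem pow_smul_coe_mulVec_single_mem_iff_forall_v_le (hσ : ∀ x, σ (σ x) = x) (hvσ : ∀ a, Valued.v (σ a) = Valued.v a)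
    (A : GL (Fin 3) K) {d : Fin 3 → K} (hd : ∀ i, Valued.v (d i) = 1)
    (hdA : Matrix.diagonal d = (-(Matrix.diagonal d).det) • formCongr σ A ((StdForm.antidiagonal 3).over K))
    {M : Submodule 𝒪[K] (Fin 3 → K)} (hM : IsSelfDualLattice σ ϖ ((StdForm.antidiagonal 3).over K) M) (m : Fin 3) (n : ℕ) :
    ϖ ^ n • ((A : Matrix (Fin 3) (Fin 3) K) *ᵥ Pi.single m 1) ∈ M ↔
      ∀ z ∈ M, Valued.v ϖ ^ n * Valued.v ((((A⁻¹ : GL (Fin 3) K) : Matrix (Fin 3) (Fin 3) K) *ᵥ z) m) ≤ 1 := by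
  have hd0 : ∀ i, d i ≠ 0 := fun i h0 => by have h := hd i; rw [h0, map_zero] at h; exact zero_ne_one h
  have hκ := v_inv_neg_det_diagonal_eq_one hd
  have hint : ∀ {x w : Fin 3 → K}, x ∈ M → w ∈ M → Valued.v (pairing σ ((StdForm.antidiagonal 3).over K) x w) ≤ 1 := fun hx hw => by
    rw [pairing_antidiagonal]; exact v_B₀_le_one_of_isSelfDualLattice hσ hvσ hM hx hw
  constructor
  · intro hu z hz
    have h := hint hu hz
    rwa [LinearMap.map_smulₛₗ₂, smul_eq_mul, pairing_single_coe_mulVec_eq A hd0 hdA, map_mul, map_mul, map_mul, hvσ, map_pow, hκ, hd m, one_mul, one_mul] at h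
  · intro h
    rw [← dualLatt_eq_self_of_isSelfDualLattice hvσ isUnit_det_antidiagonal hM, mem_dualLatt]
    intro x hx
    rw [map_smul, smul_eq_mul, pairing_coe_mulVec_single_eq A hd0 hdA, map_mul, map_mul, map_mul, map_pow, hκ, hvσ, hd m, one_mul, mul_one]
    exact h x hx

/-- **THE `u_j`- AND `u_k`-CONTENTS OF A SPLIT SELF-DUAL LATTICE AGREE**: for self-dual `M ∋ u_{i₀}` and the two other indices `j, k`: `ϖⁿu_j ∈ M → ϖⁿu_k ∈ M`
(and symmetrically). [cite: Kottwitz1986, §3] [cite: BruhatTits1972, §10] -/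
theorem pow_smul_coe_mulVec_single_mem_of_ne (hσ : ∀ x, σ (σ x) = x) (hvσ : ∀ a, Valued.v (σ a) = Valued.v a) (hϖ : Valued.v ϖ = WithZero.exp (-1 : ℤ))
    (A : GL (Fin 3) K) {d : Fin 3 → K} (hd : ∀ i, Valued.v (d i) = 1)
    (hdA : Matrix.diagonal d = (-(Matrix.diagonal d).det) • formCongr σ A ((StdForm.antidiagonal 3).over K))
    {M : Submodule 𝒪[K] (Fin 3 → K)} (hM : IsSelfDualLattice σ ϖ ((StdForm.antidiagonal 3).over K) M) {i₀ j k : Fin 3} (hj : j ≠ i₀) (hk : k ≠ i₀) (hjk : j ≠ k)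
    (hu : (A : Matrix (Fin 3) (Fin 3) K) *ᵥ Pi.single i₀ 1 ∈ M) {n : ℕ} (hn : ϖ ^ n • ((A : Matrix (Fin 3) (Fin 3) K) *ᵥ Pi.single j 1) ∈ M) :
    ϖ ^ n • ((A : Matrix (Fin 3) (Fin 3) K) *ᵥ Pi.single k 1) ∈ M := by
  have hϖ1 : Valued.v ϖ ≤ 1 := by rw [hϖ, ← WithZero.exp_zero]; exact WithZero.exp_le_exp.2 (by norm_num)
  have hpn : Valued.v ϖ ^ n ≤ 1 := pow_le_one' hϖ1 _
  rw [pow_smul_coe_mulVec_single_mem_iff_forall_v_le hσ hvσ A hd hdA hM k n]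
  rw [pow_smul_coe_mulVec_single_mem_iff_forall_v_le hσ hvσ A hd hdA hM j n] at hn
  intro z hz
  rcases le_max_iff.1 (v_coord_le_max_one_v_coord hσ hvσ A hd hdA hM hj hk hjk hu hz) with h1 | h2
  · calc Valued.v ϖ ^ n * Valued.v ((((A⁻¹ : GL (Fin 3) K) : Matrix (Fin 3) (Fin 3) K) *ᵥ z) k) ≤ 1 * 1 := mul_le_mul' hpn h1
      _ = 1 := one_mul _
  · exact (mul_le_mul' le_rfl h2).trans (hn z hz)

/-- `u_m ∈ 𝒪³` for an integral frame, hence `ϖⁿu_m ∈ ϖⁿ𝒪³`. [cite: Serre1980Trees, II.1.1] -/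
theorem pow_smul_coe_mulVec_single_mem_scaleLattice_stdLattice (hϖ : Valued.v ϖ = WithZero.exp (-1 : ℤ)) (A : GL (Fin 3) K)
    (hA : IsIntMatrix (A : Matrix (Fin 3) (Fin 3) K)) (m : Fin 3) (n : ℕ) :
    ϖ ^ n • ((A : Matrix (Fin 3) (Fin 3) K) *ᵥ Pi.single m 1) ∈ scaleLattice (ϖ ^ n) (stdLattice K 3) := by
  have hϖ0 : ϖ ≠ 0 := fun h0 => by rw [h0, map_zero] at hϖ; exact WithZero.coe_ne_zero hϖ.symm
  rw [mem_scaleLattice_iff (pow_ne_zero _ hϖ0), smul_smul, inv_mul_cancel₀ (pow_ne_zero _ hϖ0), one_smul, mem_stdLattice]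
  intro i
  rw [Matrix.mulVec_single_one, Matrix.col_apply]
  exact hA i m

/-- **`ϖⁿ·𝒪³ ≤ M ↔ ϖⁿ·u_k ∈ M`** for a self-dual `M ∋ u_{i₀}`, an integral frame `A ∈ GL₃(𝒪)` and `k ≠ i₀` (`ϖⁿ𝒪³ = Σ_m ϖⁿ𝒪·u_m`; the `u_j`-content follows the
`u_k`-content). [cite: Kottwitz1986, §3] [cite: Serre1980Trees, II.1.1] -/
theorem scaleLattice_pow_stdLattice_le_iff_pow_smul_mem (hσ : ∀ x, σ (σ x) = x) (hvσ : ∀ a, Valued.v (σ a) = Valued.v a) (hϖ : Valued.v ϖ = WithZero.exp (-1 : ℤ))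
    (A : GL (Fin 3) K) (hA : IsIntMatrix (A : Matrix (Fin 3) (Fin 3) K)) (hA' : IsIntMatrix ((A⁻¹ : GL (Fin 3) K) : Matrix (Fin 3) (Fin 3) K))
    {d : Fin 3 → K} (hd : ∀ i, Valued.v (d i) = 1) (hdA : Matrix.diagonal d = (-(Matrix.diagonal d).det) • formCongr σ A ((StdForm.antidiagonal 3).over K))
    {M : Submodule 𝒪[K] (Fin 3 → K)} (hM : IsSelfDualLattice σ ϖ ((StdForm.antidiagonal 3).over K) M) {i₀ k : Fin 3} (hk : k ≠ i₀)
    (hu : (A : Matrix (Fin 3) (Fin 3) K) *ᵥ Pi.single i₀ 1 ∈ M) (n : ℕ) :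
    scaleLattice (ϖ ^ n) (stdLattice K 3) ≤ M ↔ ϖ ^ n • ((A : Matrix (Fin 3) (Fin 3) K) *ᵥ Pi.single k 1) ∈ M := by
  have hϖ0 : ϖ ≠ 0 := fun h0 => by rw [h0, map_zero] at hϖ; exact WithZero.coe_ne_zero hϖ.symm
  have hϖ1 : Valued.v ϖ ≤ 1 := by rw [hϖ, ← WithZero.exp_zero]; exact WithZero.exp_le_exp.2 (by norm_num)
  have hpn0 : (ϖ : K) ^ n ≠ 0 := pow_ne_zero _ hϖ0
  obtain ⟨j, hj, hjk⟩ : ∃ j : Fin 3, j ≠ i₀ ∧ j ≠ k := by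
    rcases (fin_three_eq_or i₀ k).1 with h | h | h
    · exact absurd h hk
    · exact ⟨i₀ + 2, (fin_three_eq_or i₀ k).2.2.1, by rw [h]; exact (fin_three_eq_or i₀ k).2.2.2.symm⟩
    · exact ⟨i₀ + 1, (fin_three_eq_or i₀ k).2.1, by rw [h]; exact (fin_three_eq_or i₀ k).2.2.2⟩
  constructor
  · intro h
    exact h (pow_smul_coe_mulVec_single_mem_scaleLattice_stdLattice hϖ A hA k n)
  · intro hK y hy
    have hj' := pow_smul_coe_mulVec_single_mem_of_ne hσ hvσ hϖ A hd hdA hM hk hj hjk.symm hu hK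
    have hi₀ : ϖ ^ n • ((A : Matrix (Fin 3) (Fin 3) K) *ᵥ Pi.single i₀ 1) ∈ M := smul_mem_of_v_le_one M (by rw [map_pow]; exact pow_le_one' hϖ1 _) hu
    -- `y = Σ_m c_m u_m` with `|c_m| ≤ |ϖ|^n`
    have hyc : ∀ m, Valued.v ((((A⁻¹ : GL (Fin 3) K) : Matrix (Fin 3) (Fin 3) K) *ᵥ y) m) ≤ Valued.v ϖ ^ n := by
      intro m
      rw [mem_scaleLattice_stdLattice_iff hpn0] at hy
      rw [Matrix.mulVec, dotProduct]
      refine Valuation.map_sum_le _ fun l _ => ?_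
      rw [map_mul, ← map_pow]
      calc Valued.v (((A⁻¹ : GL (Fin 3) K) : Matrix (Fin 3) (Fin 3) K) m l) * Valued.v (y l) ≤ 1 * Valued.v (ϖ ^ n) := mul_le_mul' (hA' m l) (hy l)
        _ = Valued.v (ϖ ^ n) := one_mul _
    rw [← coe_mulVec_inv_mulVec A y, mulVec_eq_sum_smul_mulVec_single, sum_eq_add_add_of_ne _ hj hk hjk]
    have hterm : ∀ m, ϖ ^ n • ((A : Matrix (Fin 3) (Fin 3) K) *ᵥ Pi.single m 1) ∈ M →
        ((((A⁻¹ : GL (Fin 3) K) : Matrix (Fin 3) (Fin 3) K) *ᵥ y) m) • ((A : Matrix (Fin 3) (Fin 3) K) *ᵥ Pi.single m 1) ∈ M := by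
      intro m hm
      rw [show ((((A⁻¹ : GL (Fin 3) K) : Matrix (Fin 3) (Fin 3) K) *ᵥ y) m) = ((((A⁻¹ : GL (Fin 3) K) : Matrix (Fin 3) (Fin 3) K) *ᵥ y) m) * (ϖ ^ n)⁻¹ * ϖ ^ n by
        rw [mul_assoc, inv_mul_cancel₀ hpn0, mul_one], ← smul_smul]
      refine smul_mem_of_v_le_one M ?_ hm
      rw [map_mul, map_inv₀, map_pow]
      calc Valued.v ((((A⁻¹ : GL (Fin 3) K) : Matrix (Fin 3) (Fin 3) K) *ᵥ y) m) * (Valued.v ϖ ^ n)⁻¹ ≤ Valued.v ϖ ^ n * (Valued.v ϖ ^ n)⁻¹ := mul_le_mul' (hyc m) le_rfl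
        _ = 1 := mul_inv_cancel₀ (pow_ne_zero _ ((Valuation.ne_zero_iff _).2 hϖ0))
    exact M.add_mem (M.add_mem (hterm i₀ hi₀) (hterm j hj')) (hterm k hK)

/-- **DEPTH = CONTENT**: for a self-dual `M ∋ u_{i₀}` (integral frame, `k ≠ i₀`): `latticeDepth M ≤ n ↔ ϖⁿ·u_k ∈ M`. [cite: Serre1980Trees, II.1.1] [cite: Kottwitz1986, §3] -/
theorem latticeDepth_le_iff_pow_smul_mem (hσ : ∀ x, σ (σ x) = x) (hvσ : ∀ a, Valued.v (σ a) = Valued.v a) (hϖ : Valued.v ϖ = WithZero.exp (-1 : ℤ))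
    (A : GL (Fin 3) K) (hA : IsIntMatrix (A : Matrix (Fin 3) (Fin 3) K)) (hA' : IsIntMatrix ((A⁻¹ : GL (Fin 3) K) : Matrix (Fin 3) (Fin 3) K))
    {d : Fin 3 → K} (hd : ∀ i, Valued.v (d i) = 1) (hdA : Matrix.diagonal d = (-(Matrix.diagonal d).det) • formCongr σ A ((StdForm.antidiagonal 3).over K))
    {M : Submodule 𝒪[K] (Fin 3 → K)} (hM : IsSelfDualLattice σ ϖ ((StdForm.antidiagonal 3).over K) M) {i₀ k : Fin 3} (hk : k ≠ i₀)
    (hu : (A : Matrix (Fin 3) (Fin 3) K) *ᵥ Pi.single i₀ 1 ∈ M) (n : ℕ) :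
    latticeDepth ϖ M ≤ n ↔ ϖ ^ n • ((A : Matrix (Fin 3) (Fin 3) K) *ᵥ Pi.single k 1) ∈ M := by
  have hϖ1 : Valued.v ϖ ≤ 1 := by rw [hϖ, ← WithZero.exp_zero]; exact WithZero.exp_le_exp.2 (by norm_num)
  have hne : {j : ℕ | scaleLattice (ϖ ^ j) (stdLattice K 3) ≤ M}.Nonempty := exists_scaleLattice_pow_stdLattice_le_of_isVertexLattice hϖ hM
  rw [latticeDepth]
  constructor
  · intro h
    have hmem := Nat.sInf_mem hne
    have hm : ϖ ^ sInf {j : ℕ | scaleLattice (ϖ ^ j) (stdLattice K 3) ≤ M} • ((A : Matrix (Fin 3) (Fin 3) K) *ᵥ Pi.single k 1) ∈ M :=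
      (scaleLattice_pow_stdLattice_le_iff_pow_smul_mem hσ hvσ hϖ A hA hA' hd hdA hM hk hu _).1 hmem
    obtain ⟨e, he⟩ := Nat.exists_eq_add_of_le h
    rw [he, pow_add, mul_comm, ← smul_smul]
    exact smul_mem_of_v_le_one M (by rw [map_pow]; exact pow_le_one' hϖ1 _) hm
  · intro h
    exact Nat.sInf_le ((scaleLattice_pow_stdLattice_le_iff_pow_smul_mem hσ hvσ hϖ A hA hA' hd hdA hM hk hu n).2 h)

/-- **DISTANCE = TWICE THE CONTENT** (given the frames of the `U(3)` tree, ★ `dist_root_eq_of_frames`): for a self-dual vertex `v ∋ u_{i₀}`, `dist(r₀, v) ≤ 2n ↔ ϖⁿ·u_k ∈ v`.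
[cite: Serre1980Trees, II.1.1] [cite: BruhatTits1972, §10] -/
theorem dist_root_le_iff_pow_smul_mem_of_frames (hσ : ∀ x, σ (σ x) = x) (hvσ : ∀ a, Valued.v (σ a) = Valued.v a) (hϖ : Valued.v ϖ = WithZero.exp (-1 : ℤ))
    (hfr₀ : ∀ L : Submodule 𝒪[K] (Fin 3 → K), IsSelfDualLattice σ ϖ ((StdForm.antidiagonal 3).over K) L → ∃ κ : unitaryGroupOfForm σ ((StdForm.antidiagonal 3).over K), κ ∈ unitaryInt σ ((StdForm.antidiagonal 3).over K) ∧ ∃ a : ℤ, L = mapGL (κ : GL (Fin 3) K) (latt (Matrix.diagonal ![ϖ ^ a, 1, ϖ ^ (-a)])))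
    (hfr₂ : ∀ M : Submodule 𝒪[K] (Fin 3 → K), IsVertexLattice σ ϖ ((StdForm.antidiagonal 3).over K) 2 M → ∃ κ : unitaryGroupOfForm σ ((StdForm.antidiagonal 3).over K), κ ∈ unitaryInt σ ((StdForm.antidiagonal 3).over K) ∧ ∃ κ'' : unitaryGroupOfForm σ ((StdForm.antidiagonal 3).over K), κ'' ∈ unitaryInt σ ((StdForm.antidiagonal 3).over K) ∧ ∃ a : ℕ, ∃ t : unitaryGroupOfForm σ ((StdForm.antidiagonal 3).over K), ((t : GL (Fin 3) K) : Matrix (Fin 3) (Fin 3) K) = Matrix.diagonal ![ϖ ^ (a : ℤ), 1, (σ ϖ) ^ (-(a : ℤ))] ∧ M = mapGL (κ : GL (Fin 3) K) (mapGL (t : GL (Fin 3) K) (mapGL (κ'' : GL (Fin 3) K) (latt (Matrix.diagonal ![(1 : K), 1, ϖ])))))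
    (A : GL (Fin 3) K) (hA : IsIntMatrix (A : Matrix (Fin 3) (Fin 3) K)) (hA' : IsIntMatrix ((A⁻¹ : GL (Fin 3) K) : Matrix (Fin 3) (Fin 3) K))
    {d : Fin 3 → K} (hd : ∀ i, Valued.v (d i) = 1) (hdA : Matrix.diagonal d = (-(Matrix.diagonal d).det) • formCongr σ A ((StdForm.antidiagonal 3).over K))
    {v : {M : Submodule 𝒪[K] (Fin 3 → K) // IsVertex σ ϖ ((StdForm.antidiagonal 3).over K) M}} (hv : IsSelfDualLattice σ ϖ ((StdForm.antidiagonal 3).over K) v.1)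
    {i₀ k : Fin 3} (hk : k ≠ i₀) (hu : (A : Matrix (Fin 3) (Fin 3) K) *ᵥ Pi.single i₀ 1 ∈ v.1) (n : ℕ) :
    (latticeGraph σ ϖ ((StdForm.antidiagonal 3).over K)).dist ⟨stdLattice K 3, 0, isSelfDualLattice_stdLattice_three_of_v hϖ⟩ v ≤ 2 * n ↔
      ϖ ^ n • ((A : Matrix (Fin 3) (Fin 3) K) *ᵥ Pi.single k 1) ∈ v.1 := by
  rw [dist_root_eq_of_frames hσ hvσ hϖ hfr₀ hfr₂ v, if_pos hv, ← latticeDepth_le_iff_pow_smul_mem hσ hvσ hϖ A hA hA' hd hdA hv hk hu n]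
  omega

/-! ## §5 The hyperbolicity constraint and the anisotropic twin -/

/-- **A REGION VERTEX OTHER THAN THE ROOT FORCES A HYPERBOLIC RESIDUAL PLANE.**  Self-dual `M ∋ u_{i₀}` with `u_k ∉ M` (`k ≠ i₀`, `j` the third index): then
`−d_j∕d_k` is a norm residue — `∃ t, |t| = 1 ∧ |d_j + t·σ(t)·d_k| < 1`.  (`u_k ∉ M = M♯` gives `x ∈ M` with `|c_k(x)| > 1`; by `⟨x,x⟩ ∈ 𝒪` and `|c_{i₀}(x)| ≤ 1` the
two close coordinates have the same size and `d_jN(c_j) + d_kN(c_k)` cancels to order `< |c_j|²`; `t = c_k∕c_j`.)  In the residually ANISOTROPIC case the isoceles region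
is therefore reduced to the root (next theorem): the «bare-root» literals of the junction's census. [cite: Kottwitz1986, §3] [cite: BruhatTits1972, §10] -/
theorem exists_v_add_mul_norm_lt_one_of_not_mem (hσ : ∀ x, σ (σ x) = x) (hvσ : ∀ a, Valued.v (σ a) = Valued.v a)
    (A : GL (Fin 3) K) {d : Fin 3 → K} (hd : ∀ i, Valued.v (d i) = 1)
    (hdA : Matrix.diagonal d = (-(Matrix.diagonal d).det) • formCongr σ A ((StdForm.antidiagonal 3).over K))
    {M : Submodule 𝒪[K] (Fin 3 → K)} (hM : IsSelfDualLattice σ ϖ ((StdForm.antidiagonal 3).over K) M) {i₀ j k : Fin 3} (hj : j ≠ i₀) (hk : k ≠ i₀) (hjk : j ≠ k)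
    (hu : (A : Matrix (Fin 3) (Fin 3) K) *ᵥ Pi.single i₀ 1 ∈ M) (hnot : (A : Matrix (Fin 3) (Fin 3) K) *ᵥ Pi.single k 1 ∉ M) :
    ∃ t : K, Valued.v t = 1 ∧ Valued.v (d j + t * σ t * d k) < 1 := by
  have hd0 : ∀ i, d i ≠ 0 := fun i h0 => by have h := hd i; rw [h0, map_zero] at h; exact zero_ne_one h
  have hκ := v_inv_neg_det_diagonal_eq_one hd
  have hint : ∀ {x w : Fin 3 → K}, x ∈ M → w ∈ M → Valued.v (pairing σ ((StdForm.antidiagonal 3).over K) x w) ≤ 1 := fun hx hw => by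
    rw [pairing_antidiagonal]; exact v_B₀_le_one_of_isSelfDualLattice hσ hvσ hM hx hw
  -- a witness `x ∈ M` with `|c_k(x)| > 1`
  rw [← dualLatt_eq_self_of_isSelfDualLattice hvσ isUnit_det_antidiagonal hM, mem_dualLatt] at hnot
  push Not at hnot
  obtain ⟨x, hx, hxk⟩ := hnot
  set c : Fin 3 → K := (((A⁻¹ : GL (Fin 3) K) : Matrix (Fin 3) (Fin 3) K)) *ᵥ x with hc
  rw [pairing_coe_mulVec_single_eq A hd0 hdA, map_mul, map_mul, hκ, hvσ, hd k, one_mul, mul_one, ← hc] at hxk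
  -- `|c_j| = |c_k| > 1`
  have hkj : Valued.v (c k) ≤ Valued.v (c j) := by
    rcases le_max_iff.1 (v_coord_le_max_one_v_coord hσ hvσ A hd hdA hM hj hk hjk hu hx) with h | h
    · exact absurd h (not_le.2 hxk)
    · exact h
  have hjk' : Valued.v (c j) ≤ Valued.v (c k) := by
    rcases le_max_iff.1 (v_coord_le_max_one_v_coord hσ hvσ A hd hdA hM hk hj hjk.symm hu hx) with h | h
    · exact h.trans hxk.le
    · exact h
  have heq : Valued.v (c j) = Valued.v (c k) := le_antisymm hjk' hkj
  have hj1 : 1 < Valued.v (c j) := by rw [heq]; exact hxk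
  have hcj0 : c j ≠ 0 := fun h0 => by rw [h0, map_zero] at hj1; exact absurd hj1 (not_lt.2 zero_le)
  have hσcj0 : σ (c j) ≠ 0 := fun h0 => hcj0 (by rw [← hσ (c j), h0, map_zero])
  -- integrality of `⟨x,x⟩` and `|c_{i₀}| ≤ 1`
  have h0 : Valued.v (c i₀) ≤ 1 := by
    have h := hint hu hx
    rwa [pairing_single_coe_mulVec_eq A hd0 hdA, map_mul, map_mul, hκ, hd i₀, one_mul, one_mul] at h
  have hzz := hint hx hx
  conv at hzz => rw [← coe_mulVec_inv_mulVec A x, ← hc, pairing_coe_mulVec_coe_mulVec_eq_sum A hd0 hdA, map_mul, hκ, one_mul,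
    sum_eq_add_add_of_ne (fun i => σ (c i) * d i * c i) hj hk hjk]
  have hnum : Valued.v (σ (c j) * d j * c j + σ (c k) * d k * c k) ≤ 1 := by
    rw [show σ (c j) * d j * c j + σ (c k) * d k * c k = (σ (c i₀) * d i₀ * c i₀ + σ (c j) * d j * c j + σ (c k) * d k * c k) - σ (c i₀) * d i₀ * c i₀ by ring]
    refine (Valuation.map_sub _ _ _).trans (max_le hzz ?_)
    rw [map_mul, map_mul, hvσ, hd i₀, mul_one]
    calc Valued.v (c i₀) * Valued.v (c i₀) ≤ 1 * 1 := mul_le_mul' h0 h0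
      _ = 1 := one_mul _
  refine ⟨c k / c j, by rw [map_div₀, heq, div_self (fun h0 => hcj0 (by rw [← heq] at h0; exact (Valuation.zero_iff _).1 h0))], ?_⟩
  have hid : d j + c k / c j * σ (c k / c j) * d k = (σ (c j) * d j * c j + σ (c k) * d k * c k) / (σ (c j) * c j) := by
    rw [map_div₀]
    field_simp
  have hr2 : 1 < Valued.v (c j) * Valued.v (c j) := one_lt_mul'' hj1 hj1
  rw [hid, map_div₀, div_eq_mul_inv, map_mul, hvσ]
  calc Valued.v (σ (c j) * d j * c j + σ (c k) * d k * c k) * (Valued.v (c j) * Valued.v (c j))⁻¹ ≤ 1 * (Valued.v (c j) * Valued.v (c j))⁻¹ := mul_le_mul' hnum le_rfl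
    _ = (Valued.v (c j) * Valued.v (c j))⁻¹ := one_mul _
    _ < 1 := (inv_lt_one₀ (zero_lt_one.trans hr2)).2 hr2

/-- **THE ANISOTROPIC TWIN: a residually anisotropic plane has no region beyond the root.**  If `−d_j∕d_k` is NOT a norm residue, every self-dual `M` with
`LEV[M](ϖ^{d₀})` (isoceles eigen-data, exact close-pair gap, integral frame) is the root lattice `𝒪³`. [cite: Kottwitz1986, §3] [cite: BruhatTits1972, §10] -/
theorem eq_stdLattice_of_lev_of_anisotropic (hσ : ∀ x, σ (σ x) = x) (hvσ : ∀ a, Valued.v (σ a) = Valued.v a) (hϖ : Valued.v ϖ = WithZero.exp (-1 : ℤ))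
    (A : GL (Fin 3) K) (hA : IsIntMatrix (A : Matrix (Fin 3) (Fin 3) K)) (hA' : IsIntMatrix ((A⁻¹ : GL (Fin 3) K) : Matrix (Fin 3) (Fin 3) K))
    {d : Fin 3 → K} (hd : ∀ i, Valued.v (d i) = 1) (hdA : Matrix.diagonal d = (-(Matrix.diagonal d).det) • formCongr σ A ((StdForm.antidiagonal 3).over K))
    (s : Fin 3 → K) {γm : Matrix (Fin 3) (Fin 3) K} (hγA : γm = (A : Matrix (Fin 3) (Fin 3) K) * Matrix.diagonal s * ((A⁻¹ : GL (Fin 3) K) : Matrix (Fin 3) (Fin 3) K))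
    (i₀ : Fin 3) {d₀ : ℕ} (he : ∀ i, Valued.v (s i - 1) ≤ Valued.v ϖ ^ d₀) (hiso : ∀ m, m ≠ i₀ → Valued.v (s i₀ - s m) = Valued.v ϖ ^ d₀) {s' : ℕ}
    (hgap : ∀ j k, j ≠ i₀ → k ≠ i₀ → j ≠ k → Valued.v (s j - s k) = Valued.v ϖ ^ (d₀ + 2 * s'))
    {j k : Fin 3} (hj : j ≠ i₀) (hk : k ≠ i₀) (hjk : j ≠ k) (haniso : ¬ ∃ t : K, Valued.v t = 1 ∧ Valued.v (d j + t * σ t * d k) < 1)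
    {M : Submodule 𝒪[K] (Fin 3 → K)} (hM : IsSelfDualLattice σ ϖ ((StdForm.antidiagonal 3).over K) M)
    (hlev : M.map ((Matrix.toLin' (γm - 1)).restrictScalars 𝒪[K]) ≤ scaleLattice (ϖ ^ d₀) M) : M = stdLattice K 3 := by
  obtain ⟨hu, -⟩ := (map_sub_one_le_scaleLattice_iff_mem_and_mem_of_isSelfDualLattice hσ hvσ hϖ A hd hdA s hγA i₀ he hiso hgap hM hk).1 hlev
  have huk : (A : Matrix (Fin 3) (Fin 3) K) *ᵥ Pi.single k 1 ∈ M := by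
    by_contra hnot
    exact haniso (exists_v_add_mul_norm_lt_one_of_not_mem hσ hvσ A hd hdA hM hj hk hjk hu hnot)
  have hle : stdLattice K 3 ≤ M := by
    have h := (scaleLattice_pow_stdLattice_le_iff_pow_smul_mem hσ hvσ hϖ A hA hA' hd hdA hM hk hu 0).2 (by rw [pow_zero, one_smul]; exact huk)
    rwa [pow_zero, scaleLattice_one] at h
  exact le_antisymm (le_of_isSelfDualLattice_of_le hvσ isUnit_det_antidiagonal (isSelfDualLattice_stdLattice_three_of_v hϖ) hM hle) hle

/-! ## §6 DIST: the region lies in the ball of radius `2s'`; the END half of «END ⟺ dist = 2s'» -/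

/-- **DIST (frames form): every region vertex is within `2s'` of the root.**  A self-dual vertex `v` with `LEV[v](ϖ^{d₀})` (isoceles eigen-data at `i₀`, exact close-pair gap
`ϖ^{d₀+2s'}`, integral eigenframe with unit Gram) satisfies `dist(r₀, v) ≤ 2s'`. [cite: Kottwitz1986, §3] [cite: BruhatTits1972, §10] [cite: Serre1980Trees, II.1.1] -/
theorem dist_root_le_of_lev_of_frames (hσ : ∀ x, σ (σ x) = x) (hvσ : ∀ a, Valued.v (σ a) = Valued.v a) (hϖ : Valued.v ϖ = WithZero.exp (-1 : ℤ))
    (hfr₀ : ∀ L : Submodule 𝒪[K] (Fin 3 → K), IsSelfDualLattice σ ϖ ((StdForm.antidiagonal 3).over K) L → ∃ κ : unitaryGroupOfForm σ ((StdForm.antidiagonal 3).over K), κ ∈ unitaryInt σ ((StdForm.antidiagonal 3).over K) ∧ ∃ a : ℤ, L = mapGL (κ : GL (Fin 3) K) (latt (Matrix.diagonal ![ϖ ^ a, 1, ϖ ^ (-a)])))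
    (hfr₂ : ∀ M : Submodule 𝒪[K] (Fin 3 → K), IsVertexLattice σ ϖ ((StdForm.antidiagonal 3).over K) 2 M → ∃ κ : unitaryGroupOfForm σ ((StdForm.antidiagonal 3).over K), κ ∈ unitaryInt σ ((StdForm.antidiagonal 3).over K) ∧ ∃ κ'' : unitaryGroupOfForm σ ((StdForm.antidiagonal 3).over K), κ'' ∈ unitaryInt σ ((StdForm.antidiagonal 3).over K) ∧ ∃ a : ℕ, ∃ t : unitaryGroupOfForm σ ((StdForm.antidiagonal 3).over K), ((t : GL (Fin 3) K) : Matrix (Fin 3) (Fin 3) K) = Matrix.diagonal ![ϖ ^ (a : ℤ), 1, (σ ϖ) ^ (-(a : ℤ))] ∧ M = mapGL (κ : GL (Fin 3) K) (mapGL (t : GL (Fin 3) K) (mapGL (κ'' : GL (Fin 3) K) (latt (Matrix.diagonal ![(1 : K), 1, ϖ])))))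
    (A : GL (Fin 3) K) (hA : IsIntMatrix (A : Matrix (Fin 3) (Fin 3) K)) (hA' : IsIntMatrix ((A⁻¹ : GL (Fin 3) K) : Matrix (Fin 3) (Fin 3) K))
    {d : Fin 3 → K} (hd : ∀ i, Valued.v (d i) = 1) (hdA : Matrix.diagonal d = (-(Matrix.diagonal d).det) • formCongr σ A ((StdForm.antidiagonal 3).over K))
    (s : Fin 3 → K) {γm : Matrix (Fin 3) (Fin 3) K} (hγA : γm = (A : Matrix (Fin 3) (Fin 3) K) * Matrix.diagonal s * ((A⁻¹ : GL (Fin 3) K) : Matrix (Fin 3) (Fin 3) K))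
    (i₀ : Fin 3) {d₀ : ℕ} (he : ∀ i, Valued.v (s i - 1) ≤ Valued.v ϖ ^ d₀) (hiso : ∀ m, m ≠ i₀ → Valued.v (s i₀ - s m) = Valued.v ϖ ^ d₀) {s' : ℕ}
    (hgap : ∀ j k, j ≠ i₀ → k ≠ i₀ → j ≠ k → Valued.v (s j - s k) = Valued.v ϖ ^ (d₀ + 2 * s'))
    {v : {M : Submodule 𝒪[K] (Fin 3 → K) // IsVertex σ ϖ ((StdForm.antidiagonal 3).over K) M}} (hv : IsSelfDualLattice σ ϖ ((StdForm.antidiagonal 3).over K) v.1)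
    (hlev : v.1.map ((Matrix.toLin' (γm - 1)).restrictScalars 𝒪[K]) ≤ scaleLattice (ϖ ^ d₀) v.1) :
    (latticeGraph σ ϖ ((StdForm.antidiagonal 3).over K)).dist ⟨stdLattice K 3, 0, isSelfDualLattice_stdLattice_three_of_v hϖ⟩ v ≤ 2 * s' := by
  have hk : i₀ + 1 ≠ i₀ := (fin_three_eq_or i₀ i₀).2.1
  obtain ⟨hu, hK⟩ := (map_sub_one_le_scaleLattice_iff_mem_and_mem_of_isSelfDualLattice hσ hvσ hϖ A hd hdA s hγA i₀ he hiso hgap hv hk).1 hlev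
  exact (dist_root_le_iff_pow_smul_mem_of_frames hσ hvσ hϖ hfr₀ hfr₂ A hA hA' hd hdA hv hk hu s').2 hK

/-- **THE END HALF OF DIST (frames form)**: if a region vertex `v` is at distance EXACTLY `2s'`, then NO self-dual vertex at distance `2s' + 2` — in particular no grandchild of
`v` away from the root — carries `LEV(ϖ^{d₀})`: the vertices at distance `2s'` are END vertices of the region. [cite: Kottwitz1986, §3] [cite: BruhatTits1972, §10] -/
theorem not_lev_of_dist_root_eq_of_frames (hσ : ∀ x, σ (σ x) = x) (hvσ : ∀ a, Valued.v (σ a) = Valued.v a) (hϖ : Valued.v ϖ = WithZero.exp (-1 : ℤ))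
    (hfr₀ : ∀ L : Submodule 𝒪[K] (Fin 3 → K), IsSelfDualLattice σ ϖ ((StdForm.antidiagonal 3).over K) L → ∃ κ : unitaryGroupOfForm σ ((StdForm.antidiagonal 3).over K), κ ∈ unitaryInt σ ((StdForm.antidiagonal 3).over K) ∧ ∃ a : ℤ, L = mapGL (κ : GL (Fin 3) K) (latt (Matrix.diagonal ![ϖ ^ a, 1, ϖ ^ (-a)])))
    (hfr₂ : ∀ M : Submodule 𝒪[K] (Fin 3 → K), IsVertexLattice σ ϖ ((StdForm.antidiagonal 3).over K) 2 M → ∃ κ : unitaryGroupOfForm σ ((StdForm.antidiagonal 3).over K), κ ∈ unitaryInt σ ((StdForm.antidiagonal 3).over K) ∧ ∃ κ'' : unitaryGroupOfForm σ ((StdForm.antidiagonal 3).over K), κ'' ∈ unitaryInt σ ((StdForm.antidiagonal 3).over K) ∧ ∃ a : ℕ, ∃ t : unitaryGroupOfForm σ ((StdForm.antidiagonal 3).over K), ((t : GL (Fin 3) K) : Matrix (Fin 3) (Fin 3) K) = Matrix.diagonal ![ϖ ^ (a : ℤ), 1, (σ ϖ) ^ (-(a : ℤ))] ∧ M = mapGL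 (κ : GL (Fin 3) K) (mapGL (t : GL (Fin 3) K) (mapGL (κ'' : GL (Fin 3) K) (latt (Matrix.diagonal ![(1 : K), 1, ϖ])))))
    (A : GL (Fin 3) K) (hA : IsIntMatrix (A : Matrix (Fin 3) (Fin 3) K)) (hA' : IsIntMatrix ((A⁻¹ : GL (Fin 3) K) : Matrix (Fin 3) (Fin 3) K))
    {d : Fin 3 → K} (hd : ∀ i, Valued.v (d i) = 1) (hdA : Matrix.diagonal d = (-(Matrix.diagonal d).det) • formCongr σ A ((StdForm.antidiagonal 3).over K))
    (s : Fin 3 → K) {γm : Matrix (Fin 3) (Fin 3) K} (hγA : γm = (A : Matrix (Fin 3) (Fin 3) K) * Matrix.diagonal s * ((A⁻¹ : GL (Fin 3) K) : Matrix (Fin 3) (Fin 3) K))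
    (i₀ : Fin 3) {d₀ : ℕ} (he : ∀ i, Valued.v (s i - 1) ≤ Valued.v ϖ ^ d₀) (hiso : ∀ m, m ≠ i₀ → Valued.v (s i₀ - s m) = Valued.v ϖ ^ d₀) {s' : ℕ}
    (hgap : ∀ j k, j ≠ i₀ → k ≠ i₀ → j ≠ k → Valued.v (s j - s k) = Valued.v ϖ ^ (d₀ + 2 * s'))
    {w : {M : Submodule 𝒪[K] (Fin 3 → K) // IsVertex σ ϖ ((StdForm.antidiagonal 3).over K) M}} (hw : IsSelfDualLattice σ ϖ ((StdForm.antidiagonal 3).over K) w.1)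
    (hdist : (latticeGraph σ ϖ ((StdForm.antidiagonal 3).over K)).dist ⟨stdLattice K 3, 0, isSelfDualLattice_stdLattice_three_of_v hϖ⟩ w = 2 * s' + 2) :
    ¬ w.1.map ((Matrix.toLin' (γm - 1)).restrictScalars 𝒪[K]) ≤ scaleLattice (ϖ ^ d₀) w.1 := by
  intro hlev
  have h := dist_root_le_of_lev_of_frames hσ hvσ hϖ hfr₀ hfr₂ A hA hA' hd hdA s hγA i₀ he hiso hgap hw hlev
  omega

/-- **DIST, tame-ramified form** (frames discharged by ★ `exists_frame_mapGL_stdLattice` ∕ ★ `exists_frame_mapGL_N₁` over the transitivity theorems, as in ★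
`row_regionUpClosed_of_neg`): every self-dual vertex with `LEV(ϖ^{d₀})` is within `2s'` of the root. [cite: Kottwitz1986, §3] [cite: BruhatTits1972, §10] [cite: Tits1979, §3.5] -/
theorem dist_root_le_of_lev_of_neg (hσ : ∀ x, σ (σ x) = x) (hvσ : ∀ a, Valued.v (σ a) = Valued.v a) (hσϖ : σ ϖ = -ϖ)
    (hϖ : Valued.v ϖ = WithZero.exp (-1 : ℤ)) (hres : ∀ x : K, Valued.v x ≤ 1 → Valued.v (σ x - x) < 1) (h2 : Valued.v (2 : K) = 1)
    (hnorm : ∀ u : K, σ u = u → Valued.v (u - 1) < 1 → ∃ z : K, z * σ z = u ∧ Valued.v (z - 1) ≤ Valued.v (u - 1)) [Finite 𝓀[K]]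
    [ValuativeRel K] [(Valued.v : Valuation K ℤᵐ⁰).Compatible]
    (A : GL (Fin 3) K) (hA : IsIntMatrix (A : Matrix (Fin 3) (Fin 3) K)) (hA' : IsIntMatrix ((A⁻¹ : GL (Fin 3) K) : Matrix (Fin 3) (Fin 3) K))
    {d : Fin 3 → K} (hd : ∀ i, Valued.v (d i) = 1) (hdA : Matrix.diagonal d = (-(Matrix.diagonal d).det) • formCongr σ A ((StdForm.antidiagonal 3).over K))
    (s : Fin 3 → K) {γm : Matrix (Fin 3) (Fin 3) K} (hγA : γm = (A : Matrix (Fin 3) (Fin 3) K) * Matrix.diagonal s * ((A⁻¹ : GL (Fin 3) K) : Matrix (Fin 3) (Fin 3) K))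
    (i₀ : Fin 3) {d₀ : ℕ} (he : ∀ i, Valued.v (s i - 1) ≤ Valued.v ϖ ^ d₀) (hiso : ∀ m, m ≠ i₀ → Valued.v (s i₀ - s m) = Valued.v ϖ ^ d₀) {s' : ℕ}
    (hgap : ∀ j k, j ≠ i₀ → k ≠ i₀ → j ≠ k → Valued.v (s j - s k) = Valued.v ϖ ^ (d₀ + 2 * s'))
    {v : {M : Submodule 𝒪[K] (Fin 3 → K) // IsVertex σ ϖ ((StdForm.antidiagonal 3).over K) M}} (hv : IsSelfDualLattice σ ϖ ((StdForm.antidiagonal 3).over K) v.1)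
    (hlev : v.1.map ((Matrix.toLin' (γm - 1)).restrictScalars 𝒪[K]) ≤ scaleLattice (ϖ ^ d₀) v.1) :
    (latticeGraph σ ϖ ((StdForm.antidiagonal 3).over K)).dist ⟨stdLattice K 3, 0, isSelfDualLattice_stdLattice_three_of_v hϖ⟩ v ≤ 2 * s' := by
  refine dist_root_le_of_lev_of_frames hσ hvσ hϖ (fun L hL => ?_) (fun M hM => ?_) A hA hA' hd hdA s hγA i₀ he hiso hgap hv hlev
  · obtain ⟨u, rfl⟩ := exists_unitary_mapGL_stdLattice_eq_of_isSelfDualLattice_of_v_two hσ hvσ hϖ h2 hL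
    exact exists_frame_mapGL_stdLattice hσ hvσ hϖ u
  · obtain ⟨u, rfl⟩ := forall_isVertexLattice_two_exists_mapGL_N₁_eq_of_neg hσ hvσ hϖ hσϖ hres h2 hnorm M hM
    exact exists_frame_mapGL_N₁ hσ hvσ hϖ u

/-- **THE END HALF OF DIST, tame-ramified form**: no self-dual vertex at distance `2s' + 2` carries `LEV(ϖ^{d₀})` — the region's vertices at distance `2s'` have no region
grandchildren. [cite: Kottwitz1986, §3] [cite: BruhatTits1972, §10] [cite: Tits1979, §3.5] -/
theorem not_lev_of_dist_root_eq_of_neg (hσ : ∀ x, σ (σ x) = x) (hvσ : ∀ a, Valued.v (σ a) = Valued.v a) (hσϖ : σ ϖ = -ϖ)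
    (hϖ : Valued.v ϖ = WithZero.exp (-1 : ℤ)) (hres : ∀ x : K, Valued.v x ≤ 1 → Valued.v (σ x - x) < 1) (h2 : Valued.v (2 : K) = 1)
    (hnorm : ∀ u : K, σ u = u → Valued.v (u - 1) < 1 → ∃ z : K, z * σ z = u ∧ Valued.v (z - 1) ≤ Valued.v (u - 1)) [Finite 𝓀[K]]
    [ValuativeRel K] [(Valued.v : Valuation K ℤᵐ⁰).Compatible]
    (A : GL (Fin 3) K) (hA : IsIntMatrix (A : Matrix (Fin 3) (Fin 3) K)) (hA' : IsIntMatrix ((A⁻¹ : GL (Fin 3) K) : Matrix (Fin 3) (Fin 3) K))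
    {d : Fin 3 → K} (hd : ∀ i, Valued.v (d i) = 1) (hdA : Matrix.diagonal d = (-(Matrix.diagonal d).det) • formCongr σ A ((StdForm.antidiagonal 3).over K))
    (s : Fin 3 → K) {γm : Matrix (Fin 3) (Fin 3) K} (hγA : γm = (A : Matrix (Fin 3) (Fin 3) K) * Matrix.diagonal s * ((A⁻¹ : GL (Fin 3) K) : Matrix (Fin 3) (Fin 3) K))
    (i₀ : Fin 3) {d₀ : ℕ} (he : ∀ i, Valued.v (s i - 1) ≤ Valued.v ϖ ^ d₀) (hiso : ∀ m, m ≠ i₀ → Valued.v (s i₀ - s m) = Valued.v ϖ ^ d₀) {s' : ℕ}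
    (hgap : ∀ j k, j ≠ i₀ → k ≠ i₀ → j ≠ k → Valued.v (s j - s k) = Valued.v ϖ ^ (d₀ + 2 * s'))
    {w : {M : Submodule 𝒪[K] (Fin 3 → K) // IsVertex σ ϖ ((StdForm.antidiagonal 3).over K) M}} (hw : IsSelfDualLattice σ ϖ ((StdForm.antidiagonal 3).over K) w.1)
    (hdist : (latticeGraph σ ϖ ((StdForm.antidiagonal 3).over K)).dist ⟨stdLattice K 3, 0, isSelfDualLattice_stdLattice_three_of_v hϖ⟩ w = 2 * s' + 2) :
    ¬ w.1.map ((Matrix.toLin' (γm - 1)).restrictScalars 𝒪[K]) ≤ scaleLattice (ϖ ^ d₀) w.1 := by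
  intro hlev
  have h := dist_root_le_of_lev_of_neg hσ hvσ hσϖ hϖ hres h2 hnorm A hA hA' hd hdA s hγA i₀ he hiso hgap hw hlev
  omega

end Literature.NumberTheory.Automorphic.UnitaryLatticeTree

end
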